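import Summits.NavierStokesRegularity.NavierStokesRegularity.Theses.SwallowedContinuum
import Literature.Analysis.FluidPDE.NSQuasipotential

/-!
# Disproof of `NoDiscSwallow` — findings (birth crux-attack seed, refuter-rattack-stmt-NavierStokesRegularity-17612-0, 2026-08-17)

Crux `SwallowedContinuum.NoDiscSwallow` (stmt-NavierStokesRegularity-17612): no fibre of the
Lagrangian endpoint map `Xs = lim_{t↑T} X(t,·)` of a classical Leray–Hopf solution from a rapidly
decaying datum contains an embedded closed 2-disc. VERDICT OF THE BIRTH ATTACK: survives (no
kill); the content sits entirely at a first blow-up time `T = T*` (open: Hou's interior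
axisymmetric scenario would be the disc sector), everything below is sorry-free.

* §1 `HasDisc`, `not_hasDisc_fibre_of_injective` — the conclusion shape; an injective endpoint map
  (every `T` before blow-up, or every `T` under Clay (A) + weak–strong uniqueness) has no disc in a
  fibre, so `S → C` holds on paper and the crux is a NECESSARY condition of `NoBlowup`.
* §2 REST STATE: `hypotheses_restState` (NON-VACUITY: `u ≡ 0`, `X = id`, `Xs = id` inhabit every
  hypothesis, tree lemmas `isClassicalNSSolutionOn_zero`, `isLerayHopfOn_zero`);
  `flow_eq_id_of_zero`, `endpoint_eq_id_of_zero`, `crux_at_restState` (the crux is TRUE at the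
  rest state for every flow map / uniform limit: frozen labels by `constant_of_has_deriv_right_zero`,
  `Xs = id` by uniqueness of limits along `𝓝[<] T`).
* §3 LOAD-BEARING ANALYSIS (`_false_without_` theorems, all killed at `T = 1`):
  `noDiscSwallow_false_without_ode` / `_without_init` / `_without_limit` — each flow-map clause
  dropped is refuted already at the rest state (`Xs ≡ 0`, planar disc `planar`);
  `noDiscSwallow_false_without_NS` — the three analytic hypotheses on `(u,p)` dropped: the
  self-similar collapse `X(t,a) = (1-t)a` on `‖a‖ ≤ 2` driven by the bounded-speed field
  `u = -y/(1-t)` on the shrinking ball `‖y‖ ≤ 2(1-t)` swallows the planar unit disc into `0`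
  with `X(t,·) → Xs` uniformly on `ℝ³`. So any proof must use the Navier–Stokes / Leray–Hopf /
  decay hypotheses: bounded-speed kinematics does not exclude disc swallowing.
* Not formalised (paper only): the planner's smooth divergence-free bounded-total-speed cartoons
  (plane inflow + axial jet) inhabiting the disc sector; `NoBlowup → NoDiscSwallow` (backward ODE
  uniqueness through the common endpoint for a locally Lipschitz extension).
* Targets: none yet (no line picked at birth).
-/

open Set Filter Topology
open Literature.Analysis.FluidPDE

namespace Summit.NavierStokesRegularity.NavierStokesRegularity.Cruxes.NoDiscSwallow.Disproof

-- `<Problem> = <Summit>` duplicates `NavierStokesRegularity` in every name (lakefile sets this weakly).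
set_option linter.dupNamespace false

local notation "ℝ³" => EuclideanSpace ℝ (Fin 3)
local notation "ℝ²" => EuclideanSpace ℝ (Fin 2)

/-- the conclusion shape: an embedded closed 2-disc inside a set -/
def HasDisc (A : Set ℝ³) : Prop :=
  ∃ φ : ℝ² → ℝ³, ContinuousOn φ (Metric.closedBall 0 1) ∧ InjOn φ (Metric.closedBall 0 1) ∧
    MapsTo φ (Metric.closedBall 0 1) A

lemma two_points : (0 : ℝ²) ∈ Metric.closedBall (0 : ℝ²) 1 ∧
    EuclideanSpace.single (0 : Fin 2) (1 : ℝ) ∈ Metric.closedBall (0 : ℝ²) 1 ∧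
    (0 : ℝ²) ≠ EuclideanSpace.single (0 : Fin 2) (1 : ℝ) := by
  refine ⟨by simp, by simp, ?_⟩
  intro h
  have := congrArg (fun v : ℝ² => v 0) h
  simp at this

lemma not_hasDisc_of_subsingleton {A : Set ℝ³} (hA : A.Subsingleton) : ¬ HasDisc A := by
  rintro ⟨φ, -, hinj, hmaps⟩
  obtain ⟨h0, h1, hne⟩ := two_points
  exact hne (hinj h0 h1 (hA (hmaps h0) (hmaps h1)))

/-- no disc in any fibre of an injective map -/
lemma not_hasDisc_fibre_of_injective {Xs : ℝ³ → ℝ³} (h : Function.Injective Xs) (x : ℝ³) :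
    ¬ HasDisc (Xs ⁻¹' {x}) :=
  not_hasDisc_of_subsingleton fun a ha b hb => h (by
    simp only [mem_preimage, mem_singleton_iff] at ha hb
    rw [ha, hb])

/-! ### (2) the rest state -/

/-- frozen labels: with `u ≡ 0`, any flow map is the identity on `[0,T)` -/
lemma flow_eq_id_of_zero {T : ℝ} {X : ℝ → ℝ³ → ℝ³} (h0 : ∀ a, X 0 a = a)
    (hode : ∀ a, ∀ t ∈ Ico 0 T,
      HasDerivWithinAt (fun s => X s a) ((0 : ℝ → ℝ³ → ℝ³) t (X t a)) (Ico 0 T) t) :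
    ∀ a, ∀ t ∈ Ico 0 T, X t a = a := by
  intro a t ht
  have hcont : ContinuousOn (fun s => X s a) (Icc 0 t) := by
    intro s hs
    have hs' : s ∈ Ico 0 T := ⟨hs.1, lt_of_le_of_lt hs.2 ht.2⟩
    exact (hode a s hs').continuousWithinAt.mono fun r hr => ⟨hr.1, lt_of_le_of_lt hr.2 ht.2⟩
  have hderiv : ∀ s ∈ Ico 0 t, HasDerivWithinAt (fun s => X s a) 0 (Ici s) s := by
    intro s hs
    have hs' : s ∈ Ico 0 T := ⟨hs.1, hs.2.trans ht.2⟩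
    have h := hode a s hs'
    simp only [Pi.zero_apply] at h
    exact h.mono_of_mem_nhdsWithin
      (mem_of_superset (Ico_mem_nhdsGE hs'.2) (Ico_subset_Ico_left hs'.1))
  have := constant_of_has_deriv_right_zero hcont hderiv t ⟨ht.1, le_rfl⟩
  rw [this, h0]

/-- … hence the endpoint map of the rest state is the identity -/
lemma endpoint_eq_id_of_zero {T : ℝ} (hT : 0 < T) {X : ℝ → ℝ³ → ℝ³} {Xs : ℝ³ → ℝ³}
    (h0 : ∀ a, X 0 a = a)
    (hode : ∀ a, ∀ t ∈ Ico 0 T,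
      HasDerivWithinAt (fun s => X s a) ((0 : ℝ → ℝ³ → ℝ³) t (X t a)) (Ico 0 T) t)
    (hlim : TendstoUniformly X Xs (𝓝[<] T)) : ∀ a, Xs a = a := by
  intro a
  have h1 : Tendsto (fun t => X t a) (𝓝[<] T) (𝓝 (Xs a)) := hlim.tendsto_at a
  have h2 : (fun t => X t a) =ᶠ[𝓝[<] T] fun _ => a := by
    filter_upwards [Ico_mem_nhdsLT hT] with t ht
    exact flow_eq_id_of_zero h0 hode a t ht
  have h3 : Tendsto (fun t => X t a) (𝓝[<] T) (𝓝 a) := (tendsto_congr' h2).mpr tendsto_const_nhds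
  exact tendsto_nhds_unique h1 h3

/-- `NoDiscSwallow` specialised to the rest state `u ≡ 0` HOLDS (whatever `p`, `ν`). -/
theorem noDiscSwallow_restState {T : ℝ} (hT : 0 < T) (X : ℝ → ℝ³ → ℝ³) (Xs : ℝ³ → ℝ³)
    (h0 : ∀ a, X 0 a = a)
    (hode : ∀ a, ∀ t ∈ Ico 0 T,
      HasDerivWithinAt (fun s => X s a) ((0 : ℝ → ℝ³ → ℝ³) t (X t a)) (Ico 0 T) t)
    (hlim : TendstoUniformly X Xs (𝓝[<] T)) (x : ℝ³) : ¬ HasDisc (Xs ⁻¹' {x}) := by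
  have hid : ∀ a, Xs a = a := endpoint_eq_id_of_zero hT h0 hode hlim
  refine not_hasDisc_fibre_of_injective (fun a b hab => ?_) x
  rwa [hid, hid] at hab

/-- The zero datum decays rapidly. -/
theorem hasRapidSpatialDecay_zero : HasRapidSpatialDecay (0 : ℝ³ → ℝ³) := fun n K =>
  ⟨0, fun x => by
    have : iteratedFDeriv ℝ n (0 : ℝ³ → ℝ³) x = 0 := by
      rw [Pi.zero_def, iteratedFDeriv_fun_zero]; rfl
    rw [this, norm_zero, mul_zero]⟩

/-- NON-VACUITY: the rest state with the identity flow inhabits every hypothesis of the crux. -/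
theorem hypotheses_restState (ν T : ℝ) :
    IsClassicalNSSolutionOn (Ico 0 T) ν 0 (0 : ℝ → ℝ³ → ℝ³) 0 ∧
    IsLerayHopfOn T ν 0 ((0 : ℝ → ℝ³ → ℝ³) 0) 0 ∧
    HasRapidSpatialDecay ((0 : ℝ → ℝ³ → ℝ³) 0) ∧
    (∀ a : ℝ³, (fun (_ : ℝ) (b : ℝ³) => b) 0 a = a) ∧
    (∀ a : ℝ³, ∀ t ∈ Ico 0 T, HasDerivWithinAt (fun s => (fun (_ : ℝ) (b : ℝ³) => b) s a)
      ((0 : ℝ → ℝ³ → ℝ³) t ((fun (_ : ℝ) (b : ℝ³) => b) t a)) (Ico 0 T) t) ∧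
    TendstoUniformly (fun (_ : ℝ) (b : ℝ³) => b) id (𝓝[<] T) := by
  refine ⟨isClassicalNSSolutionOn_zero _ _, by simpa using isLerayHopfOn_zero (E := ℝ³) T ν,
    by simpa using hasRapidSpatialDecay_zero, fun a => rfl, fun a t _ => ?_, ?_⟩
  · simpa using hasDerivWithinAt_const t (Ico 0 T) a
  · intro U hU
    exact Filter.Eventually.of_forall fun t a => refl_mem_uniformity hU

/-! ### (3) mutations: each flow-map clause is load-bearing, already at the rest state -/

/-- the coordinate embedding `ℝ² ↪ ℝ³`, `(y₀, y₁) ↦ (y₀, y₁, 0)` -/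
noncomputable def planar (y : ℝ²) : ℝ³ :=
  (y 0) • EuclideanSpace.single (0 : Fin 3) (1 : ℝ) + (y 1) • EuclideanSpace.single (1 : Fin 3) (1 : ℝ)

lemma planar_apply_zero (y : ℝ²) : planar y 0 = y 0 := by
  simp [planar]

lemma planar_apply_one (y : ℝ²) : planar y 1 = y 1 := by
  simp [planar]

lemma continuous_planar : Continuous planar := by
  unfold planar
  fun_prop

lemma injective_planar : Function.Injective planar := by
  intro y y' h
  have h0 : y 0 = y' 0 := by rw [← planar_apply_zero y, h, planar_apply_zero]
  have h1 : y 1 = y' 1 := by rw [← planar_apply_one y, h, planar_apply_one]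
  ext i
  fin_cases i
  · exact h0
  · exact h1

lemma hasDisc_univ : HasDisc (univ : Set ℝ³) :=
  ⟨planar, continuous_planar.continuousOn, injective_planar.injOn, fun _ _ => mem_univ _⟩

lemma hasDisc_fibre_const (c : ℝ³) : HasDisc ((fun _ : ℝ³ => c) ⁻¹' {c}) := by
  have : ((fun _ : ℝ³ => c) ⁻¹' {c}) = univ := by ext a; simp
  rw [this]; exact hasDisc_univ

/-- the crux with the ODE clause `∂ₛX = u(s, X)` DROPPED -/
def NoDiscSwallowWithoutODE : Prop :=
  ∀ (ν T : ℝ), 0 < ν → 0 < T → ∀ (u : ℝ → ℝ³ → ℝ³) (p : ℝ → ℝ³ → ℝ),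
    IsClassicalNSSolutionOn (Ico 0 T) ν 0 u p → IsLerayHopfOn T ν 0 (u 0) u →
    HasRapidSpatialDecay (u 0) →
    ∀ (X : ℝ → ℝ³ → ℝ³) (Xs : ℝ³ → ℝ³), (∀ a, X 0 a = a) →
      TendstoUniformly X Xs (𝓝[<] T) →
      ∀ x : ℝ³, ¬ ∃ φ : ℝ² → ℝ³, ContinuousOn φ (Metric.closedBall 0 1) ∧
        InjOn φ (Metric.closedBall 0 1) ∧ MapsTo φ (Metric.closedBall 0 1) (Xs ⁻¹' {x})

/-- … is FALSE at the rest state: `X t = id` for `t = 0`, `X t ≡ 0` for `t ≠ 0`, `Xs ≡ 0`. -/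
theorem noDiscSwallow_false_without_ode : ¬ NoDiscSwallowWithoutODE := by
  intro h
  obtain ⟨hcl, hLH, hdec, -, -, -⟩ := hypotheses_restState (1 : ℝ) 1
  refine h 1 1 one_pos one_pos 0 0 hcl hLH hdec (fun t a => if t = 0 then a else 0) (fun _ => 0)
    (fun a => by simp) ?_ 0 (hasDisc_fibre_const 0)
  intro U hU
  filter_upwards [Ioo_mem_nhdsLT one_pos] with t ht
  intro a
  have ht0 : (t : ℝ) ≠ 0 := ne_of_gt ht.1
  simp only [ht0, if_false]
  exact refl_mem_uniformity hU

/-- the crux with the initial clause `X 0 = id` DROPPED -/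
def NoDiscSwallowWithoutInit : Prop :=
  ∀ (ν T : ℝ), 0 < ν → 0 < T → ∀ (u : ℝ → ℝ³ → ℝ³) (p : ℝ → ℝ³ → ℝ),
    IsClassicalNSSolutionOn (Ico 0 T) ν 0 u p → IsLerayHopfOn T ν 0 (u 0) u →
    HasRapidSpatialDecay (u 0) →
    ∀ (X : ℝ → ℝ³ → ℝ³) (Xs : ℝ³ → ℝ³),
      (∀ a, ∀ t ∈ Ico 0 T, HasDerivWithinAt (fun s => X s a) (u t (X t a)) (Ico 0 T) t) →
      TendstoUniformly X Xs (𝓝[<] T) →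
      ∀ x : ℝ³, ¬ ∃ φ : ℝ² → ℝ³, ContinuousOn φ (Metric.closedBall 0 1) ∧
        InjOn φ (Metric.closedBall 0 1) ∧ MapsTo φ (Metric.closedBall 0 1) (Xs ⁻¹' {x})

/-- … is FALSE at the rest state: `X ≡ 0`, `Xs ≡ 0`. -/
theorem noDiscSwallow_false_without_init : ¬ NoDiscSwallowWithoutInit := by
  intro h
  obtain ⟨hcl, hLH, hdec, -, -, -⟩ := hypotheses_restState (1 : ℝ) 1
  refine h 1 1 one_pos one_pos 0 0 hcl hLH hdec (fun _ _ => 0) (fun _ => 0)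
    (fun a t _ => ?_) ?_ 0 (hasDisc_fibre_const 0)
  · simpa using hasDerivWithinAt_const t (Ico (0 : ℝ) 1) (0 : ℝ³)
  · intro U hU
    exact Filter.Eventually.of_forall fun t a => refl_mem_uniformity hU

/-- the crux with the uniform-limit clause `X(t,·) → Xs` DROPPED (so `Xs` is unconstrained) -/
def NoDiscSwallowWithoutLimit : Prop :=
  ∀ (ν T : ℝ), 0 < ν → 0 < T → ∀ (u : ℝ → ℝ³ → ℝ³) (p : ℝ → ℝ³ → ℝ),
    IsClassicalNSSolutionOn (Ico 0 T) ν 0 u p → IsLerayHopfOn T ν 0 (u 0) u →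
    HasRapidSpatialDecay (u 0) →
    ∀ (X : ℝ → ℝ³ → ℝ³) (Xs : ℝ³ → ℝ³), (∀ a, X 0 a = a) →
      (∀ a, ∀ t ∈ Ico 0 T, HasDerivWithinAt (fun s => X s a) (u t (X t a)) (Ico 0 T) t) →
      ∀ x : ℝ³, ¬ ∃ φ : ℝ² → ℝ³, ContinuousOn φ (Metric.closedBall 0 1) ∧
        InjOn φ (Metric.closedBall 0 1) ∧ MapsTo φ (Metric.closedBall 0 1) (Xs ⁻¹' {x})

/-- … is FALSE at the rest state: `X t = id`, `Xs ≡ 0`. -/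
theorem noDiscSwallow_false_without_limit : ¬ NoDiscSwallowWithoutLimit := by
  intro h
  obtain ⟨hcl, hLH, hdec, h0, hode, -⟩ := hypotheses_restState (1 : ℝ) 1
  exact h 1 1 one_pos one_pos 0 0 hcl hLH hdec (fun _ b => b) (fun _ => 0) h0 hode 0
    (hasDisc_fibre_const 0)

/-! ### (4) the crux, restricted to the rest state, in its literal binder shape -/

/-- the crux, restricted to the rest state, in its literal binder shape -/
theorem crux_at_restState (ν T : ℝ) (_hν : 0 < ν) (hT : 0 < T) (p : ℝ → ℝ³ → ℝ)
    (_hcl : IsClassicalNSSolutionOn (Ico 0 T) ν 0 (0 : ℝ → ℝ³ → ℝ³) p)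
    (_hLH : IsLerayHopfOn T ν 0 ((0 : ℝ → ℝ³ → ℝ³) 0) 0)
    (_hdec : HasRapidSpatialDecay ((0 : ℝ → ℝ³ → ℝ³) 0))
    (X : ℝ → ℝ³ → ℝ³) (Xs : ℝ³ → ℝ³) (h0 : ∀ a, X 0 a = a)
    (hode : ∀ a, ∀ t ∈ Ico 0 T,
      HasDerivWithinAt (fun s => X s a) ((0 : ℝ → ℝ³ → ℝ³) t (X t a)) (Ico 0 T) t)
    (hlim : TendstoUniformly X Xs (𝓝[<] T)) (x : ℝ³) :
    ¬ ∃ φ : ℝ² → ℝ³, ContinuousOn φ (Metric.closedBall 0 1) ∧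
        InjOn φ (Metric.closedBall 0 1) ∧ MapsTo φ (Metric.closedBall 0 1) (Xs ⁻¹' {x}) :=
  noDiscSwallow_restState hT X Xs h0 hode hlim x

/-! ### (3b) the analytic hypotheses on `(u, p)` are load-bearing: kinematics alone swallows discs -/

lemma norm_planar_le (y : ℝ²) : ‖planar y‖ ≤ 2 * ‖y‖ := by
  unfold planar
  calc ‖(y 0) • EuclideanSpace.single (0 : Fin 3) (1 : ℝ) +
          (y 1) • EuclideanSpace.single (1 : Fin 3) (1 : ℝ)‖
        ≤ ‖(y 0) • EuclideanSpace.single (0 : Fin 3) (1 : ℝ)‖ +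
          ‖(y 1) • EuclideanSpace.single (1 : Fin 3) (1 : ℝ)‖ := norm_add_le _ _
    _ = ‖y 0‖ + ‖y 1‖ := by
          rw [norm_smul, norm_smul, PiLp.norm_single, PiLp.norm_single]
          simp
    _ ≤ ‖y‖ + ‖y‖ := add_le_add (PiLp.norm_apply_le y 0) (PiLp.norm_apply_le y 1)
    _ = 2 * ‖y‖ := by ring

/-- the crux with the three ANALYTIC hypotheses (`IsClassicalNSSolutionOn`, `IsLerayHopfOn`,
`HasRapidSpatialDecay`) DROPPED: `u` is an arbitrary velocity field, only the flow clauses remain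
(the pressure binder, now idle, is omitted). -/
def NoDiscSwallowWithoutNS : Prop :=
  ∀ (ν T : ℝ), 0 < ν → 0 < T → ∀ (u : ℝ → ℝ³ → ℝ³),
    ∀ (X : ℝ → ℝ³ → ℝ³) (Xs : ℝ³ → ℝ³), (∀ a, X 0 a = a) →
      (∀ a, ∀ t ∈ Ico 0 T, HasDerivWithinAt (fun s => X s a) (u t (X t a)) (Ico 0 T) t) →
      TendstoUniformly X Xs (𝓝[<] T) →
      ∀ x : ℝ³, ¬ ∃ φ : ℝ² → ℝ³, ContinuousOn φ (Metric.closedBall 0 1) ∧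
        InjOn φ (Metric.closedBall 0 1) ∧ MapsTo φ (Metric.closedBall 0 1) (Xs ⁻¹' {x})

/-- **Kinematics alone swallows a disc** (`T = 1`): the labels of the closed ball `‖a‖ ≤ 2`
collapse self-similarly to the origin, `X(t,a) = (1-t)a`, driven by the bounded-speed field
`u(t,y) = -y/(1-t)` on the shrinking ball `‖y‖ ≤ 2(1-t)` (speed ≤ 2) and `u = 0` outside, the
other labels frozen; `X(t,·) → Xs` uniformly with `Xs = 0` on the ball, so the fibre over `0`
contains the planar unit disc. Hence any proof of the crux must use the Navier–Stokes hypotheses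
on `u` (this `u` is neither smooth nor divergence free — the planner's smooth divergence-free
cartoons are not formalised here). -/
theorem noDiscSwallow_false_without_NS : ¬ NoDiscSwallowWithoutNS := by
  intro h
  -- the witness
  let X : ℝ → ℝ³ → ℝ³ := fun t a => if ‖a‖ ≤ 2 then (1 - t) • a else a
  let Xs : ℝ³ → ℝ³ := fun a => if ‖a‖ ≤ 2 then 0 else a
  let u : ℝ → ℝ³ → ℝ³ := fun t y => if ‖y‖ ≤ 2 * (1 - t) then -((1 - t)⁻¹ • y) else 0
  refine h 1 1 one_pos one_pos u X Xs (fun a => by simp [X]) ?_ ?_ 0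
    ⟨planar, continuous_planar.continuousOn, injective_planar.injOn, fun y hy => ?_⟩
  · -- the ODE along every label
    intro a t ht
    have ht1 : 0 < 1 - t := sub_pos.2 ht.2
    by_cases ha : ‖a‖ ≤ 2
    · have hX : (fun s => X s a) = fun s => (1 - s) • a := by
        funext s; simp [X, ha]
      have hXt : X t a = (1 - t) • a := by simp [X, ha]
      have hnorm : ‖(1 - t) • a‖ ≤ 2 * (1 - t) := by
        rw [norm_smul, Real.norm_eq_abs, abs_of_pos ht1]
        nlinarith
      have hu : u t (X t a) = (-1 : ℝ) • a := by
        rw [hXt]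
        simp only [u, hnorm, if_true, smul_smul, inv_mul_cancel₀ ht1.ne', one_smul, neg_one_smul]
      rw [hX, hu]
      exact (((hasDerivAt_id t).const_sub 1).smul_const a).hasDerivWithinAt
    · have hX : (fun s => X s a) = fun _ => a := by
        funext s; simp [X, ha]
      have hXt : X t a = a := by simp [X, ha]
      have hnot : ¬ ‖a‖ ≤ 2 * (1 - t) := fun h' => ha (by nlinarith [ht.1])
      have hu : u t (X t a) = 0 := by
        rw [hXt]; simp only [u, hnot, if_false]
      rw [hX, hu]
      exact hasDerivWithinAt_const t _ a
  · -- uniform convergence on all of ℝ³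
    rw [Metric.tendstoUniformly_iff]
    intro ε hε
    filter_upwards [Ioo_mem_nhdsLT (show 1 - ε / 3 < (1 : ℝ) by linarith)] with t ht
    intro a
    have ht1 : 0 < 1 - t := sub_pos.2 ht.2
    by_cases ha : ‖a‖ ≤ 2
    · simp only [Xs, X, ha, if_true, dist_zero_left, norm_smul, Real.norm_eq_abs, abs_of_pos ht1]
      nlinarith [ht.1, norm_nonneg a]
    · simp only [Xs, X, ha, if_false, dist_self]
      exact hε
  · -- the planar unit disc lies in the fibre over `0`
    have hy1 : ‖y‖ ≤ 1 := by simpa using hy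
    have h2 : ‖planar y‖ ≤ 2 := (norm_planar_le y).trans (by linarith)
    show Xs (planar y) ∈ ({0} : Set ℝ³)
    simp [Xs, h2]

end Summit.NavierStokesRegularity.NavierStokesRegularity.Cruxes.NoDiscSwallow.Disproof
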